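import Summits.Ventures.HSemireg.UntwistFullSigma
import Mathlib.Data.Nat.Choose.Sum
import Mathlib.Algebra.Module.Rat
import HarnessLib

/-!
# Venture HSemireg — the MULTIPLIER of the untwisting step: from the Leibniz rule
# `At(E′) = θ(At E) + c` to `σ_{E′} ∘ θ = exp(c) ∪ σ_E` (route R1.0 (iii), first implication)

HONEST FRAMING. Pure algebra in an abstract associative ring `R` read as Buchweitz–Flenner's Yoneda algebra
`A_E = ⊕_{i,j} Extⁱ(E, E ⊗ Ωʲ)` of a perfect complex `E` ([BuchweitzFlenner2003] §4, before Prop. 4.2: «carries a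
natural algebra structure that is associative but in general not graded commutative»), followed by its composition
with the kernel clause of `UntwistFullSigma.lean` (and, in `UntwistAssembly.lean`, with the files in which `θ` is a
real map). No variety, no gerbe, no functor is constructed; no definition,
no named fact; nothing here says HC, HC_CM or HC_AV is proved. Every geometric input enters as an explicit
HYPOTHESIS of a theorem, with its printed source named in the docstring.

## The step being served (cell pub-hsemireg, `general-structure/PERRY-SUBSTITUTE-GS.md` §1 (R1.0); th-1
## `theory/TH1-PERRY-RESIDUE.md` §4 «(T)»; referee note `theory/TH4-UNTWIST-LEMMA.md`)

R1.0 (iii) as printed in the cell: «`σ_{E₀′} = σ_{E₀} · exp(∓at(L))` (`At(L)` central) ⇒ injective iff `σ_{E₀}`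
is», for `E₀′ = π^*E₀ ⊗ L^{∓1}` on the `μ₂`-gerbe `π : 𝔊₀ → X₀` of square roots of `P` (`L² = π^*P`,
`c₁(L) = c₁(P)/2`; numbers of the STEP-0 component: `Ext²_{X₀}(E₀, E₀)` of dimension `18`, target
`⊕_q H^{q+2}(X₀, Ω^q)` of dimension `28`), or, in the untwisted reading, `E′ = E₀ ⊗ M_B` on `X₀` itself. The
sibling files prove the SECOND implication (the kernel clause: `UntwistFullSigma.lean`, taking the triangular
re-expansion `σ′_q(θ ξ) = d_q(σ_q ξ) + Σ_{j<q} u_{q,j}(σ_j ξ)` with ARBITRARY mixing maps `u` as hypothesis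
`hσ`), the identification `θ` (`UntwistExtEquivalence`, `UntwistGerbePullback`, `UntwistGerbeWeights`,
`UntwistDerivedTheta`, `UntwistDerivedAdjunction`) and the class bookkeeping (`UntwistKappaClass`). THIS file
proves the FIRST implication: the printed inputs

* (Leibniz rule) `At(F ⊗ M) = At(F) ⊗ 1_M + 1_F ⊗ At(M)` — [Atiyah1957] Prop. 10 (extensions) and Prop. 11
  «`b(E ⊗ E′) = b(E) ⊗ I′ + I ⊗ b(E′)`» (Trans. AMS 85, p. 196), Prop. 12 «Let `E` be a line-bundle over `X`,
  then `b(E) ∈ H¹(X, Ω¹)` is given by `b(E) = -2πi c(E)`» (held text, READ; Prop. 12 is stated under Atiyah's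
  standing hypothesis «we suppose throughout that `X` is a compact Kähler manifold», p. 196 — the algebraic / gerbe
  reading of the dictionary below is on paper only, red-2 R203); for complexes
  [HuybrechtsLehn1997] §10.1.5, last display p. 260 «`A(E• ⊗ F•) = A(E•) ⊗ id_F + id_E ⊗ A(F•)`» (READ);
  under pull-back [BuchweitzFlenner2003] Prop. 3.14 p. 162 («the Atiyah class `At^k(F)` is mapped onto the
  Atiyah class `At^k(Lf^*(F))`», READ);
* (commutation) the twisting class commutes with the image of `At(E)`: in `A_{E ⊗ M}`,
  `(At(E) ⊗ 1)·(1 ⊗ At(M)) = At(E) ⊗ At(M) = (1 ⊗ At(M))·(At(E) ⊗ 1)` — the Leibniz rule's two summands and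
  the interchange law (bifunctoriality) of `- ⊗ -`, up to the Koszul sign of two classes of EVEN total degree
  `2`, i.e. they COMMUTE ([HuybrechtsLehn1997] §10.1.5 with the sign rule of §10.1.1; th-1 (P1) 16:25Z). The
  decisive consistency check is the multiplicativity `ch(E ⊗ M) = ch(E)·ch(M)` of `ch = Tr exp(-At)`
  ([BuchweitzFlenner2003] Def. 4.1, [HuybrechtsLehn1997] §10.1.6), which `trace_add_pow_eq_sum_choose` below
  reproduces and which would already fail at `q = 2` if the two classes anticommuted. [BuchweitzFlenner2003]
  Prop. 3.12 p. 161 («`At^k(F)` … is a (graded) central element of degree `k` … `ξ · At^k(F) = (-1)^{ik}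
  At^k(F) · ξ` for every `ξ ∈ Extⁱ_X(F, F)`», READ) is the printed form-degree-`0` frame (centrality of `At^k`
  against `Ext•(F, F)`), recorded for orientation and NOT the instance used: `c = 1 ⊗ At(M)` has form degree
  `1`. Only the relation `Commute (θ a) c` enters below, as a binder;
* (trace) `Tr : Ext^k(F, F ⊗ G) → H^k(X, G)` exists for perfect `F` and is compatible with cup products and with
  inverse images — [BuchweitzFlenner2003] §4.1 p. 165 L1–6 («natural trace map … see [Ill]»; §4 «These maps are
  compatible with taking cup products»; Rem. 4.7 (1) «the trace map is compatible with taking inverse images»),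
  [HuybrechtsLehn1997] Lemma 10.1.3 p. 258 (i) «`tr ∘ i = rk(E•) · id`» (READ);

imply, for `σ_q(ξ) = Tr_q(ξ · At^q)` (the tree's normalisation of `HodgeTheory/SemiregularityHigherSigma.lean`,
no `1/q!`) and `a′ = θ(a) + c`:

  **`σ′_q(θ ξ) = Σ_{j ≤ q} (q choose j) · c^{q-j} ∪ d(σ_j ξ)`**  (`sigma_leibniz_eq_sum_choose`),

i.e. exactly the triangular shape of `UntwistFullSigma` with diagonal `d_q` and the mixing maps now EXPLICIT,
`u_{q,j} = (q choose j) · (c^{q-j} ∪ –) ∘ d_j` (`sigma_leibniz_triangular`); in Buchweitz–Flenner's normalisation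
`σ^{BF}_q = ((-1)^q/q!) σ_q` this reads **`σ^{BF}_{E′}(θ ξ) = exp(-c) ∪ d(σ^{BF}_E ξ)`** componentwise
(`sigma_leibniz_exp`, over `ℚ`-vector spaces) — the printed «`σ_{E₀′} = σ_{E₀} · exp(∓at(L))`» with
`c = ∓At(L) = ∓c₁(P)/2` (the sign of the root is immaterial here). The same identity with `ξ = 1` is the Newton /
Chern-character bookkeeping `Tr′((a′)^q) = Σ_j (q choose j) c^{q-j} ∪ d Tr(a^j)` (`trace_add_pow_eq_sum_choose`;
[HuybrechtsLehn1997] §10.1.6 `γ^i(F) = tr(A(F)^i)`), whose degree-one case `Tr′(a′) = d Tr(a) + c ∪ Tr′(1)`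
(`trace_leibniz_degree_one`) is the dictionary line «`c₁(E ⊗ L) = c₁(E) + rk(E) · c₁(L)`» that
`UntwistKappaClass.lean` takes as a binder (`c′ = c + r • l`).

## Dictionary (how the abstract data is read; none of it is constructed here)

* `R = A_E`, `R′ = A_{E′}` (total Yoneda algebras), `θ : R →+* R′` the ring map `ξ ↦ π^*ξ ⊗ 1_{L^{∓1}}`
  (untwisted reading: `ξ ↦ ξ ⊗ 1_{M_B}`; it is unital and multiplicative: `𝓔nd(E ⊗ M) = 𝓔nd(E)` for a line
  bundle `M`, pull-back is a ring map); `A = Ext²(E, E) = A_E^{2,0}` with its inclusion `ι : A →+ R`, `θ₀ = θ|_A`;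
* `a = At(E) ∈ A_E^{1,1}`, `a′ = At(E′)`, `c = 1_{E′} ⊗ At(L^{∓1}) = ∓c₁(L)` (image of `H¹(Ω¹)` in `A_{E′}^{1,1}`);
  the Leibniz rule is the hypothesis `ha′ : a′ = θ a + c`, the commutation (interchange law) the hypothesis
  `hc : Commute (θ a) c`;
* `W q = H^{q+2}(X₀, Ω^q)`, `W′ q = H^{q+2}(𝔊₀, Ω^q)` (or `= W q` in the untwisted reading), `τ_q : R →+ W q` the
  trace on the bidegree-`(q+2, q)` component extended by zero, `d_q : W q →+ W′ q` the comparison `π^*` (resp.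
  `id`), with `hd : τ′_q ∘ θ = d_q ∘ τ_q` (trace compatible with inverse images / with `𝓔nd(E ⊗ M) = 𝓔nd E`; in the
  untwisted reading `d = id` uses `Tr_{E ⊗ M}(y ⊗ 1_M) = rk(M) · Tr_E(y)` with `rk M = 1` — LINE bundles `M` only, ref-2 (P3));
* `μ_{q,j} : W′ j →+ W′ q` the cup product with `c^{q-j}` on Hodge cohomology, with
  `hμ : τ′_q(y · c^{q-j}) = μ_{q,j}(τ′_j y)` (`j ≤ q`; trace compatible with cup products — for `y` of the wrong
  bidegree both sides vanish).

All statements are universally quantified over these data; they are [folklore] algebra (binomial theorem for two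
commuting elements, `Commute.add_pow`, and additivity), recorded because the cell's referee protocol wants the
first «⇒» of R1.0 (iii) in the tree and because they make the mixing maps `u_{q,j}` of `UntwistFullSigma` explicit.
What is NOT here: the ring `A_E` on real carriers (the tree's `sigmaHigher` is a Yoneda composite in `X.Modules`,
`HodgeTheory/SemiregularityHigherSigma.lean` «Not here: the full algebra structure of `A`»), the functors `π^*`,
`- ⊗ L^{∓1}`, and the Leibniz rule itself on real carriers (Atiyah Prop. 10 on the tree's twisted jet sequences —
a separate construction); `σ_q` for complexes (seat p3).

## References

* [Atiyah1957] M. F. Atiyah, *Complex analytic connections in fibre bundles*, Trans. Amer. Math. Soc. 85 (1957)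
  181–207, Prop. 10, 11, 12 (pp. 195–196).
* [BuchweitzFlenner2003] R.-O. Buchweitz, H. Flenner, *A semiregularity map for modules and applications to
  deformations*, Compositio Math. 137 (2003) 135–210: Prop. 3.12 (p. 161, frame only), Prop. 3.14 (p. 162), §4.1 (p. 165), Def. 4.1
  (p. 166), Rem. 4.7 (1), §5 (`I`-semiregular).
* [HuybrechtsLehn1997] D. Huybrechts, M. Lehn, *The geometry of moduli spaces of sheaves*, CUP (held copy
  ISBN 9780521134200 = 2nd ed. 2010; page numbers from it), §10.1.2–10.1.6 (Lemma 10.1.3 p. 258; last display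
  of §10.1.5 p. 260; `γ^i = tr(A^i)` p. 260).
* [Markman2025SecantWeil] E. Markman, arXiv:2502.03415, §1.3 (`κ(ch) = exp(-ch₁/r) ch`), §7.3 (twist by a twisted line
  bundle: `κ(𝓑) = κ(𝓑′)`).
-/

namespace Summit.Ventures.HSemireg

open Finset

/-! ### 1. The binomial re-expansion of traces under `a′ = θ a + c` (pure algebra) -/

section LeibnizTrace

variable {R R' : Type*} [Ring R] [Ring R'] {W W' : ℕ → Type*}
  [∀ q, AddCommGroup (W q)] [∀ q, AddCommGroup (W' q)]

/-- **Traces of `x · (θ a + c)^q`, binomial form.** Let `θ : R → R′` be a ring map, `a ∈ R`, `c ∈ R′` with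
`θ a` and `c` commuting, `τ_q : R → W_q`, `τ′_q : R′ → W′_q` additive («traces»), `d_q : W_q → W′_q` with
`τ′_q ∘ θ = d_q ∘ τ_q`, and `μ_{q,j} : W′_j → W′_q` with `τ′_q(y · c^{q-j}) = μ_{q,j}(τ′_j y)` for `j ≤ q` («cup
with `c^{q-j}`»). Then for every `x ∈ R`:
`τ′_q(θ x · (θ a + c)^q) = Σ_{j ≤ q} (q choose j) · μ_{q,j}(d_j(τ_j(x · a^j)))`.
(Read: `Tr((ξ ⊗ 1) · At(E ⊗ M)^q) = Σ_j (q choose j) c₁(M)^{q-j} ∪ Tr(ξ · At(E)^j)` from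
`At(E ⊗ M) = At(E) ⊗ 1 + 1 ⊗ At(M)`.) [folklore] [cite: Atiyah1957, Prop. 10–12]
[cite: HuybrechtsLehn1997, §10.1.5 (Leibniz rule, interchange law)] [cite: BuchweitzFlenner2003, §4.1 (trace)] -/
theorem trace_mul_add_pow_eq_sum_choose (θ : R →+* R') {a : R} {c : R'} (hc : Commute (θ a) c)
    (τ : ∀ q, R →+ W q) (τ' : ∀ q, R' →+ W' q) (d : ∀ q, W q →+ W' q)
    (hd : ∀ (q : ℕ) (y : R), τ' q (θ y) = d q (τ q y))
    (μ : ∀ q j, W' j →+ W' q)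
    (hμ : ∀ (q j : ℕ) (y : R'), j ≤ q → τ' q (y * c ^ (q - j)) = μ q j (τ' j y))
    (q : ℕ) (x : R) :
    τ' q (θ x * (θ a + c) ^ q) =
      ∑ j ∈ range (q + 1), q.choose j • μ q j (d j (τ j (x * a ^ j))) := by
  rw [hc.add_pow, mul_sum, map_sum]
  refine sum_congr rfl fun j hj => ?_
  have hjq : j ≤ q := Nat.lt_succ_iff.mp (mem_range.mp hj)
  rw [← map_pow θ a j, ← mul_assoc, ← mul_assoc, ← map_mul θ x (a ^ j), ← nsmul_eq_mul', map_nsmul,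
    hμ q j _ hjq, hd]

/-- **Traces of the powers `(θ a + c)^q` themselves** (the case `x = 1`): the Newton-polynomial / Chern-character
bookkeeping `Tr′(At(E′)^q) = Σ_{j ≤ q} (q choose j) · c^{q-j} ∪ d Tr(At(E)^j)`, i.e. `ch(E ⊗ M) = ch(E) · exp(c₁ M)`
componentwise after dividing by `q!`. [folklore] [cite: HuybrechtsLehn1997, §10.1.5–10.1.6 (p. 260)] -/
theorem trace_add_pow_eq_sum_choose (θ : R →+* R') {a : R} {c : R'} (hc : Commute (θ a) c)
    (τ : ∀ q, R →+ W q) (τ' : ∀ q, R' →+ W' q) (d : ∀ q, W q →+ W' q)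
    (hd : ∀ (q : ℕ) (y : R), τ' q (θ y) = d q (τ q y))
    (μ : ∀ q j, W' j →+ W' q)
    (hμ : ∀ (q j : ℕ) (y : R'), j ≤ q → τ' q (y * c ^ (q - j)) = μ q j (τ' j y))
    (q : ℕ) :
    τ' q ((θ a + c) ^ q) = ∑ j ∈ range (q + 1), q.choose j • μ q j (d j (τ j (a ^ j))) := by
  have h := trace_mul_add_pow_eq_sum_choose θ hc τ τ' d hd μ hμ q 1
  simp_rw [map_one, one_mul] at h
  exact h

/-- **Degree one**: `Tr′(θ a + c) = d(Tr a) + μ_{1,0}(Tr′ 1)` — the dictionary line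
`c₁(E ⊗ M) = c₁(E) + rk(E) · c₁(M)` (`Tr′(1_{E′}) = rk`, [HuybrechtsLehn1997] Lemma 10.1.3 (i)), the binder
`c′ = c + r • l` of `UntwistKappaClass.lean`. [folklore] [cite: HuybrechtsLehn1997, Lemma 10.1.3 (i) (p. 258)] -/
theorem trace_leibniz_degree_one (θ : R →+* R') {a : R} {c : R'}
    (τ : ∀ q, R →+ W q) (τ' : ∀ q, R' →+ W' q) (d : ∀ q, W q →+ W' q)
    (hd : ∀ (q : ℕ) (y : R), τ' q (θ y) = d q (τ q y))
    (μ : ∀ q j, W' j →+ W' q)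
    (hμ : ∀ (q j : ℕ) (y : R'), j ≤ q → τ' q (y * c ^ (q - j)) = μ q j (τ' j y)) :
    τ' 1 (θ a + c) = d 1 (τ 1 a) + μ 1 0 (τ' 0 1) := by
  rw [map_add, hd, ← one_mul c, ← pow_one c]
  exact congrArg _ (hμ 1 0 1 (Nat.zero_le 1))

end LeibnizTrace

/-! ### 2. The multiplier formula for the semiregularity components and the triangular shape -/

section LeibnizSigma

variable {R R' : Type*} [Ring R] [Ring R'] {W W' : ℕ → Type*}
  [∀ q, AddCommGroup (W q)] [∀ q, AddCommGroup (W' q)]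
  {A A' : Type*} [AddCommGroup A] [AddCommGroup A']
  {σ : ∀ q, A →+ W q} {σ' : ∀ q, A' →+ W' q}

/-- **The multiplier formula, binomial normalisation** (route R1.0 (iii), first implication). Data as in
`trace_mul_add_pow_eq_sum_choose`, plus the degree-`(2,0)` parts `ι : A = Ext²(E, E) → R`, `ι′ : A′ → R′`, the
restriction `θ₀ : A → A′` of `θ` (`ι′ ∘ θ₀ = θ ∘ ι`), and the semiregularity components in the tree's
normalisation `σ_q(ξ) = τ_q(ι ξ · a^q)`, `σ′_q(ξ′) = τ′_q(ι′ ξ′ · a′^q)` with the LEIBNIZ RULE `a′ = θ a + c`. Then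
**`σ′_q(θ₀ ξ) = Σ_{j ≤ q} (q choose j) · μ_{q,j}(d_j(σ_j ξ))`** («`σ_{E′}(θ ξ) = exp(c) ∪ σ_E(ξ)`» up to the
factorials of the normalisation). [folklore] [cite: Atiyah1957, Prop. 10–12]
[cite: HuybrechtsLehn1997, §10.1.5] [cite: BuchweitzFlenner2003, §4.1 and Def. 4.1] -/
theorem sigma_leibniz_eq_sum_choose (θ : R →+* R') {a : R} {a' c : R'} (ha' : a' = θ a + c)
    (hc : Commute (θ a) c)
    (τ : ∀ q, R →+ W q) (τ' : ∀ q, R' →+ W' q) (d : ∀ q, W q →+ W' q)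
    (hd : ∀ (q : ℕ) (y : R), τ' q (θ y) = d q (τ q y))
    (μ : ∀ q j, W' j →+ W' q)
    (hμ : ∀ (q j : ℕ) (y : R'), j ≤ q → τ' q (y * c ^ (q - j)) = μ q j (τ' j y))
    (ι : A →+ R) (ι' : A' →+ R') (θ₀ : A →+ A') (hθ₀ : ∀ ξ, ι' (θ₀ ξ) = θ (ι ξ))
    (hσ : ∀ (q : ℕ) (ξ : A), σ q ξ = τ q (ι ξ * a ^ q))
    (hσ' : ∀ (q : ℕ) (ξ' : A'), σ' q ξ' = τ' q (ι' ξ' * a' ^ q)) (q : ℕ) (ξ : A) :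
    σ' q (θ₀ ξ) = ∑ j ∈ range (q + 1), q.choose j • μ q j (d j (σ j ξ)) := by
  simp_rw [hσ', hθ₀, ha', hσ]
  exact trace_mul_add_pow_eq_sum_choose θ hc τ τ' d hd μ hμ q (ι ξ)

/-- **The diagonal term is `d_q(σ_q ξ)`**: `μ_{q,q}` (cup with `c⁰ = 1`) is the identity on traces.
[folklore] -/
theorem mu_self_apply_d_sigma (θ : R →+* R') {a : R} {c : R'}
    (τ : ∀ q, R →+ W q) (τ' : ∀ q, R' →+ W' q) (d : ∀ q, W q →+ W' q)
    (hd : ∀ (q : ℕ) (y : R), τ' q (θ y) = d q (τ q y))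
    (μ : ∀ q j, W' j →+ W' q)
    (hμ : ∀ (q j : ℕ) (y : R'), j ≤ q → τ' q (y * c ^ (q - j)) = μ q j (τ' j y))
    (ι : A →+ R) (hσ : ∀ (q : ℕ) (ξ : A), σ q ξ = τ q (ι ξ * a ^ q)) (q : ℕ) (ξ : A) :
    μ q q (d q (σ q ξ)) = d q (σ q ξ) := by
  rw [hσ, ← hd, ← hμ q q _ le_rfl, Nat.sub_self, pow_zero, mul_one]

/-- **The triangular shape with EXPLICIT mixing maps** (the hypothesis `hσ` of `UntwistFullSigma.lean`,
DERIVED from the Leibniz rule): `σ′_q(θ₀ ξ) = d_q(σ_q ξ) + Σ_{j<q} (q choose j) · μ_{q,j}(d_j(σ_j ξ))`.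
[folklore] [cite: Atiyah1957, Prop. 10–12] [cite: BuchweitzFlenner2003, Def. 4.1] -/
theorem sigma_leibniz_triangular (θ : R →+* R') {a : R} {a' c : R'} (ha' : a' = θ a + c)
    (hc : Commute (θ a) c)
    (τ : ∀ q, R →+ W q) (τ' : ∀ q, R' →+ W' q) (d : ∀ q, W q →+ W' q)
    (hd : ∀ (q : ℕ) (y : R), τ' q (θ y) = d q (τ q y))
    (μ : ∀ q j, W' j →+ W' q)
    (hμ : ∀ (q j : ℕ) (y : R'), j ≤ q → τ' q (y * c ^ (q - j)) = μ q j (τ' j y))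
    (ι : A →+ R) (ι' : A' →+ R') (θ₀ : A →+ A') (hθ₀ : ∀ ξ, ι' (θ₀ ξ) = θ (ι ξ))
    (hσ : ∀ (q : ℕ) (ξ : A), σ q ξ = τ q (ι ξ * a ^ q))
    (hσ' : ∀ (q : ℕ) (ξ' : A'), σ' q ξ' = τ' q (ι' ξ' * a' ^ q)) (q : ℕ) (ξ : A) :
    σ' q (θ₀ ξ) = d q (σ q ξ) + ∑ j ∈ range q,
      ((μ q j).comp ((d j).comp (DistribSMul.toAddMonoidHom (W j) (q.choose j)))) (σ j ξ) := by
  rw [sigma_leibniz_eq_sum_choose θ ha' hc τ τ' d hd μ hμ ι ι' θ₀ hθ₀ hσ hσ' q ξ, sum_range_succ,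
    Nat.choose_self, one_smul, mu_self_apply_d_sigma θ τ τ' d hd μ hμ ι hσ q ξ, add_comm]
  refine congrArg _ (sum_congr rfl fun j _ => ?_)
  rw [AddMonoidHom.comp_apply, AddMonoidHom.comp_apply, DistribSMul.toAddMonoidHom_apply, map_nsmul,
    map_nsmul]

/-- **Lower-set vanishing is transported** (the Leibniz rule fed into the kernel clause of
`UntwistFullSigma`): if the diagonal maps `d_q` are injective for `q ∈ I`, `I ⊆ ℕ` a LOWER set, then
`(∀ q ∈ I, σ′_q(θ₀ ξ) = 0) ↔ (∀ q ∈ I, σ_q ξ = 0)`. [folklore] [cite: BuchweitzFlenner2003, §5 (I-semiregular)] -/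
theorem forall_mem_sigma_apply_eq_zero_iff_of_leibniz (θ : R →+* R') {a : R} {a' c : R'} (ha' : a' = θ a + c)
    (hc : Commute (θ a) c)
    (τ : ∀ q, R →+ W q) (τ' : ∀ q, R' →+ W' q) (d : ∀ q, W q →+ W' q)
    (hd : ∀ (q : ℕ) (y : R), τ' q (θ y) = d q (τ q y))
    (μ : ∀ q j, W' j →+ W' q)
    (hμ : ∀ (q j : ℕ) (y : R'), j ≤ q → τ' q (y * c ^ (q - j)) = μ q j (τ' j y))
    (ι : A →+ R) (ι' : A' →+ R') (θ₀ : A →+ A') (hθ₀ : ∀ ξ, ι' (θ₀ ξ) = θ (ι ξ))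
    (hσ : ∀ (q : ℕ) (ξ : A), σ q ξ = τ q (ι ξ * a ^ q))
    (hσ' : ∀ (q : ℕ) (ξ' : A'), σ' q ξ' = τ' q (ι' ξ' * a' ^ q))
    {I : Set ℕ} (hI : IsLowerSet I) (hdI : ∀ q ∈ I, Function.Injective (d q)) (ξ : A) :
    (∀ q ∈ I, σ' q (θ₀ ξ) = 0) ↔ ∀ q ∈ I, σ q ξ = 0 :=
  forall_mem_apply_eq_zero_iff_of_triangular θ₀ d
    (fun q j => (μ q j).comp ((d j).comp (DistribSMul.toAddMonoidHom (W j) (q.choose j)))) hI hdI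
    (fun q _ ξ => sigma_leibniz_triangular θ ha' hc τ τ' d hd μ hμ ι ι' θ₀ hθ₀ hσ hσ' q ξ) ξ

/-- **Joint injectivity on a lower set is invariant under untwisting** (R1.0 (iii), both implications
composed): with the Leibniz data above, `θ₀ : Ext²(E, E) ≃ Ext²(E′, E′)` an additive BIJECTION (R1.0 (i)) and
the diagonal `d_q` injective on the lower set `I` (intended `π^*` on Hodge cohomology, or `id`),
`(σ_q)_{q ∈ I}` is jointly injective iff `(σ′_q)_{q ∈ I}` is. For `I = univ` this is «`σ_{E₀′}` injective iff
`σ_{E₀}` is»; a single component is NOT transported (`UntwistFullSigma.exists_unitriangular_not_transporting_singleton`).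
[folklore] [cite: BuchweitzFlenner2003, Def. 4.1 and §5 (I-semiregular)] -/
theorem jointlyInjective_iff_of_leibniz (θ : R →+* R') {a : R} {a' c : R'} (ha' : a' = θ a + c)
    (hc : Commute (θ a) c)
    (τ : ∀ q, R →+ W q) (τ' : ∀ q, R' →+ W' q) (d : ∀ q, W q →+ W' q)
    (hd : ∀ (q : ℕ) (y : R), τ' q (θ y) = d q (τ q y))
    (μ : ∀ q j, W' j →+ W' q)
    (hμ : ∀ (q j : ℕ) (y : R'), j ≤ q → τ' q (y * c ^ (q - j)) = μ q j (τ' j y))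
    (ι : A →+ R) (ι' : A' →+ R') (θ₀ : A ≃+ A') (hθ₀ : ∀ ξ, ι' (θ₀ ξ) = θ (ι ξ))
    (hσ : ∀ (q : ℕ) (ξ : A), σ q ξ = τ q (ι ξ * a ^ q))
    (hσ' : ∀ (q : ℕ) (ξ' : A'), σ' q ξ' = τ' q (ι' ξ' * a' ^ q))
    {I : Set ℕ} (hI : IsLowerSet I) (hdI : ∀ q ∈ I, Function.Injective (d q)) :
    (∀ ξ : A, (∀ q ∈ I, σ q ξ = 0) → ξ = 0) ↔ ∀ ξ' : A', (∀ q ∈ I, σ' q ξ' = 0) → ξ' = 0 :=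
  jointlyInjective_iff_of_triangular θ₀ d
    (fun q j => (μ q j).comp ((d j).comp (DistribSMul.toAddMonoidHom (W j) (q.choose j)))) hI hdI
    fun q _ ξ => sigma_leibniz_triangular θ ha' hc τ τ' d hd μ hμ ι ι' θ₀.toAddMonoidHom
      (fun ξ => hθ₀ ξ) hσ hσ' q ξ

/-- **The direction route R1.0 consumes** (scheme ⇒ gerbe / `E₀ ⇒ E₀ ⊗ M_B`): joint injectivity of
`(σ_q)_{q ∈ I}` on `Ext²(E, E)`, a SURJECTIVE `θ₀` and injective diagonals on the lower set `I` give joint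
injectivity of `(σ′_q)_{q ∈ I}`. [folklore] [cite: BuchweitzFlenner2003, §5 (I-semiregular)] -/
theorem jointlyInjective_of_leibniz_of_surjective (θ : R →+* R') {a : R} {a' c : R'} (ha' : a' = θ a + c)
    (hc : Commute (θ a) c)
    (τ : ∀ q, R →+ W q) (τ' : ∀ q, R' →+ W' q) (d : ∀ q, W q →+ W' q)
    (hd : ∀ (q : ℕ) (y : R), τ' q (θ y) = d q (τ q y))
    (μ : ∀ q j, W' j →+ W' q)
    (hμ : ∀ (q j : ℕ) (y : R'), j ≤ q → τ' q (y * c ^ (q - j)) = μ q j (τ' j y))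
    (ι : A →+ R) (ι' : A' →+ R') (θ₀ : A →+ A') (hθ : Function.Surjective θ₀)
    (hθ₀ : ∀ ξ, ι' (θ₀ ξ) = θ (ι ξ))
    (hσ : ∀ (q : ℕ) (ξ : A), σ q ξ = τ q (ι ξ * a ^ q))
    (hσ' : ∀ (q : ℕ) (ξ' : A'), σ' q ξ' = τ' q (ι' ξ' * a' ^ q))
    {I : Set ℕ} (hI : IsLowerSet I) (hdI : ∀ q ∈ I, Function.Injective (d q))
    (h : ∀ ξ : A, (∀ q ∈ I, σ q ξ = 0) → ξ = 0) (ξ' : A') (hξ' : ∀ q ∈ I, σ' q ξ' = 0) : ξ' = 0 :=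
  jointlyInjective_of_triangular_of_surjective θ₀ hθ d
    (fun q j => (μ q j).comp ((d j).comp (DistribSMul.toAddMonoidHom (W j) (q.choose j)))) hI hdI
    (fun q _ ξ => sigma_leibniz_triangular θ ha' hc τ τ' d hd μ hμ ι ι' θ₀ hθ₀ hσ hσ' q ξ) h ξ' hξ'

/-- **The converse direction** (gerbe ⇒ scheme): joint injectivity of `(σ′_q)_{q ∈ I}`, an INJECTIVE `θ₀`
(no injectivity of the diagonal needed) give joint injectivity of `(σ_q)_{q ∈ I}`, `I` a lower set.
[folklore] [cite: BuchweitzFlenner2003, §5 (I-semiregular)] -/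
theorem jointlyInjective_of_leibniz_of_injective (θ : R →+* R') {a : R} {a' c : R'} (ha' : a' = θ a + c)
    (hc : Commute (θ a) c)
    (τ : ∀ q, R →+ W q) (τ' : ∀ q, R' →+ W' q) (d : ∀ q, W q →+ W' q)
    (hd : ∀ (q : ℕ) (y : R), τ' q (θ y) = d q (τ q y))
    (μ : ∀ q j, W' j →+ W' q)
    (hμ : ∀ (q j : ℕ) (y : R'), j ≤ q → τ' q (y * c ^ (q - j)) = μ q j (τ' j y))
    (ι : A →+ R) (ι' : A' →+ R') (θ₀ : A →+ A') (hθ : Function.Injective θ₀)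
    (hθ₀ : ∀ ξ, ι' (θ₀ ξ) = θ (ι ξ))
    (hσ : ∀ (q : ℕ) (ξ : A), σ q ξ = τ q (ι ξ * a ^ q))
    (hσ' : ∀ (q : ℕ) (ξ' : A'), σ' q ξ' = τ' q (ι' ξ' * a' ^ q))
    {I : Set ℕ} (hI : IsLowerSet I)
    (h : ∀ ξ' : A', (∀ q ∈ I, σ' q ξ' = 0) → ξ' = 0) (ξ : A) (hξ : ∀ q ∈ I, σ q ξ = 0) : ξ = 0 :=
  jointlyInjective_of_triangular_of_injective θ₀ hθ d
    (fun q j => (μ q j).comp ((d j).comp (DistribSMul.toAddMonoidHom (W j) (q.choose j)))) hI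
    (fun q _ ξ => sigma_leibniz_triangular θ ha' hc τ τ' d hd μ hμ ι ι' θ₀ hθ₀ hσ hσ' q ξ) h ξ hξ

end LeibnizSigma

/-! ### 3. Buchweitz–Flenner's normalisation: `σ^{BF}_{E′}(θ ξ) = exp(-c) ∪ d σ^{BF}_E(ξ)` -/

section ExpForm

variable {R R' : Type*} [Ring R] [Ring R'] {W W' : ℕ → Type*}
  [∀ q, AddCommGroup (W q)] [∀ q, AddCommGroup (W' q)] [∀ q, Module ℚ (W q)] [∀ q, Module ℚ (W' q)]
  {A A' : Type*} [AddCommGroup A] [AddCommGroup A']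
  {σ : ∀ q, A →+ W q} {σ' : ∀ q, A' →+ W' q}

/-- `(q choose j)/q! = 1/((q-j)! j!)` in `ℚ`, `j ≤ q`. [folklore] -/
theorem inv_factorial_mul_choose_eq {q j : ℕ} (hjq : j ≤ q) :
    ((Nat.factorial q : ℚ))⁻¹ * (q.choose j : ℚ) =
      ((Nat.factorial (q - j) : ℚ))⁻¹ * ((Nat.factorial j : ℚ))⁻¹ := by
  have hq : (Nat.factorial q : ℚ) ≠ 0 := by exact_mod_cast Nat.factorial_ne_zero q
  have hj : (Nat.factorial j : ℚ) ≠ 0 := by exact_mod_cast Nat.factorial_ne_zero j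
  have hqj : (Nat.factorial (q - j) : ℚ) ≠ 0 := by exact_mod_cast Nat.factorial_ne_zero (q - j)
  have h := Nat.choose_mul_factorial_mul_factorial hjq
  rw [inv_mul_eq_iff_eq_mul₀ hq, ← mul_inv, eq_mul_inv_iff_mul_eq₀ (mul_ne_zero hqj hj)]
  exact_mod_cast (by rw [← h]; ring : q.choose j * ((q - j).factorial * j.factorial) = q.factorial)

/-- **The multiplier formula in Buchweitz–Flenner's normalisation** `σ^{BF}_q := ((-1)^q/q!) · σ_q`
(`σ = Tr(∗ · exp(-At))`, Def. 4.1): over `ℚ`-vector spaces,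
`((-1)^q/q!) σ′_q(θ₀ ξ) = Σ_{j ≤ q} ((-1)^{q-j}/(q-j)!) · μ_{q,j}(d_j(((-1)^j/j!) σ_j ξ))`, i.e. reading
`μ_{q,j} = c^{q-j} ∪`: **`σ^{BF}_{E′}(θ ξ) = exp(-c) ∪ d(σ^{BF}_E ξ)`** — the cell's printed
«`σ_{E₀′} = σ_{E₀} · exp(∓at(L))`», with `c = 1 ⊗ At(L^{∓1})`. [folklore]
[cite: BuchweitzFlenner2003, Def. 4.1] [cite: Atiyah1957, Prop. 10–12] -/
theorem sigma_leibniz_exp (θ : R →+* R') {a : R} {a' c : R'} (ha' : a' = θ a + c)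
    (hc : Commute (θ a) c)
    (τ : ∀ q, R →+ W q) (τ' : ∀ q, R' →+ W' q) (d : ∀ q, W q →+ W' q)
    (hd : ∀ (q : ℕ) (y : R), τ' q (θ y) = d q (τ q y))
    (μ : ∀ q j, W' j →+ W' q)
    (hμ : ∀ (q j : ℕ) (y : R'), j ≤ q → τ' q (y * c ^ (q - j)) = μ q j (τ' j y))
    (ι : A →+ R) (ι' : A' →+ R') (θ₀ : A →+ A') (hθ₀ : ∀ ξ, ι' (θ₀ ξ) = θ (ι ξ))
    (hσ : ∀ (q : ℕ) (ξ : A), σ q ξ = τ q (ι ξ * a ^ q))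
    (hσ' : ∀ (q : ℕ) (ξ' : A'), σ' q ξ' = τ' q (ι' ξ' * a' ^ q)) (q : ℕ) (ξ : A) :
    ((-1 : ℚ) ^ q * ((Nat.factorial q : ℚ))⁻¹) • σ' q (θ₀ ξ) =
      ∑ j ∈ range (q + 1), ((-1 : ℚ) ^ (q - j) * ((Nat.factorial (q - j) : ℚ))⁻¹) •
        μ q j (d j (((-1 : ℚ) ^ j * ((Nat.factorial j : ℚ))⁻¹) • σ j ξ)) := by
  rw [sigma_leibniz_eq_sum_choose θ ha' hc τ τ' d hd μ hμ ι ι' θ₀ hθ₀ hσ hσ' q ξ, smul_sum]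
  refine sum_congr rfl fun j hj => ?_
  have hjq : j ≤ q := Nat.lt_succ_iff.mp (mem_range.mp hj)
  rw [map_rat_smul, map_rat_smul, smul_smul, ← Nat.cast_smul_eq_nsmul ℚ, smul_smul]
  congr 1
  rw [mul_assoc, inv_factorial_mul_choose_eq hjq]
  conv_rhs => rw [mul_mul_mul_comm, ← pow_add, Nat.sub_add_cancel hjq]

end ExpForm

end Summit.Ventures.HSemireg
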